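import Mathlib
import Literature.Analysis.FluidPDE.TypeIICoreWitness
import HarnessLib

/-!
# Crux `ColumnarCoreExclusion` (stmt-NavierStokesRegularity-1966), line `columnar_comparison_flow`:
# the axial window average of the core slice is EXACTLY columnar and `2V/K`-close on the half core
# ball — the `C⁰` step of the construction stub `stub_columnarComparisonFlow`

`--supports stmt-NavierStokesRegularity-1966` (helper file; theorems only, no definitions, no `sorry`).

The registered construction stub `stub_columnarComparisonFlow` of the line
`Cruxes/ColumnarCoreExclusion/Lines/columnar_comparison_flow.lean` starts from the datum "average `u(t)`
along the witness axis `Q e_z` over the window `|τ| ≤ KL/2` (this is `2V/K`-close to `u(t)` on the half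
ball because `u(t)` is `V/K`-close to the `z`-independent `V·QW`)", then corrects its (small) horizontal
divergence, extends, and launches a global 2½-dimensional flow.  This file proves the quoted first step,
for an arbitrary continuous slice `f` (= `u t`):

* `norm_sub_axialWindowAverage_le_of_close` — in witness coordinates: if `V⁻¹ g(L·)` is `K⁻¹`-close on
  `‖y‖ ≤ K` to a columnar profile `W` (`IsColumnar W`), then for `‖Y‖ ≤ KL/2` the window average
  `ḡ Y := (KL)⁻¹ ∫_{−KL/2}^{KL/2} g(Y + (τ − Y₂) e_z) dτ` satisfies `‖g Y − ḡ Y‖ ≤ 2V/K` (every sample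
  point `Y + (τ − Y₂)e_z` lies in the closed core ball `‖·‖ ≤ KL`, where both samples are `V/K`-close to
  the same value of the `z`-independent profile);
* `exists_columnar_axialWindowAverage_close` / `…_ball` — in physical coordinates and in the literal
  shape of the stub's clauses: `v₀ x := Q ḡ(Q⁻¹(x − x₀))` is invariant under the translations
  `x ↦ x + τ • Q e_z` (the stub's columnarity clause), bounded by `V`, and `‖u t x − v₀ x‖ ≤ 2V/K` on
  `ball x₀ (K * L / 2)` — so `A = 2` before the divergence correction.

WHAT THIS IS NOT: the divergence correction (`div_h ḡ = −(g₃(top) − g₃(bottom))/(KL) = O(V/(K²L))` on the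
half disc, to be removed by an `O(V/K)` corrector), the exterior extension, and the global 2½D flow (the
tree has the two-dimensional torus theory `Torus.exists_classicalNS_forced_fin_two`, but no passive-scalar
/ columnar-lift plumbing yet); nor the shadowing stub.  Nothing here closes a stub, the crux, or says
anything about Navier–Stokes regularity.
-/

noncomputable section

open Literature.Analysis.FluidPDE Set Metric MeasureTheory Real

namespace Summit.NavierStokesRegularity.NavierStokesRegularity.Theorems

-- the problem directory repeats the summit name (`NavierStokesRegularity/NavierStokesRegularity`)
set_option linter.dupNamespace false

namespace ColumnarComparisonDatum

/-- The axial sample point `Y + (τ − Y₂) e_z` has coordinates `(Y₀, Y₁, τ)`, so its norm is at most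
`K L` when `‖Y‖ ≤ KL/2` and `|τ| ≤ KL/2`. [folklore] -/
theorem norm_axialSample_le {K L : ℝ} (hKL : 0 ≤ K * L) (Y : EuclideanSpace ℝ (Fin 3))
    (hY : ‖Y‖ ≤ K * L / 2) {τ : ℝ} (hτ : |τ| ≤ K * L / 2) :
    ‖Y + (τ - Y 2) • eZ‖ ≤ K * L := by
  have hsq : ‖Y + (τ - Y 2) • eZ‖ ^ 2 = Y 0 ^ 2 + Y 1 ^ 2 + τ ^ 2 := by
    rw [EuclideanSpace.real_norm_sq_eq, Fin.sum_univ_three]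
    simp [eZ]
  have hYsq : ‖Y‖ ^ 2 = Y 0 ^ 2 + Y 1 ^ 2 + Y 2 ^ 2 := by
    rw [EuclideanSpace.real_norm_sq_eq, Fin.sum_univ_three]
  have hτsq : τ ^ 2 ≤ (K * L / 2) ^ 2 := by
    rw [← sq_abs]; exact pow_le_pow_left₀ (abs_nonneg τ) hτ 2
  have hY2 : ‖Y‖ ^ 2 ≤ (K * L / 2) ^ 2 := pow_le_pow_left₀ (norm_nonneg Y) hY 2
  have h : ‖Y + (τ - Y 2) • eZ‖ ^ 2 ≤ (K * L) ^ 2 := by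
    rw [hsq]; nlinarith [sq_nonneg (Y 2)]
  exact (pow_le_pow_iff_left₀ (norm_nonneg _) hKL two_ne_zero).1 h

/-- The axial integrand `τ ↦ g (Y + (τ − Y₂) e_z)` of a continuous field is continuous. [folklore] -/
theorem continuous_axialIntegrand {g : EuclideanSpace ℝ (Fin 3) → EuclideanSpace ℝ (Fin 3)}
    (hg : Continuous g) (Y : EuclideanSpace ℝ (Fin 3)) :
    Continuous fun τ : ℝ => g (Y + (τ - Y 2) • eZ) :=
  hg.comp (continuous_const.add ((continuous_id.sub continuous_const).smul continuous_const))

/-- **Averaging a pointwise sample bound** over the axial window: if every sample `g(Y + (τ − Y₂)e_z)`,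
`τ ∈ [−KL/2, KL/2]`, is `C`-close to `g Y` (`KL > 0`), then so is the window average
`ḡ Y = (KL)⁻¹ ∫_{−KL/2}^{KL/2} g(Y + (τ − Y₂)e_z) dτ`. [folklore] -/
theorem norm_sub_axialWindowAverage_le {g : EuclideanSpace ℝ (Fin 3) → EuclideanSpace ℝ (Fin 3)}
    (hg : Continuous g) {K L : ℝ} (hKL : 0 < K * L) {Y : EuclideanSpace ℝ (Fin 3)} {C : ℝ}
    (h : ∀ τ : ℝ, |τ| ≤ K * L / 2 → ‖g (Y + (τ - Y 2) • eZ) - g Y‖ ≤ C) :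
    ‖g Y - (K * L)⁻¹ • ∫ τ in (-(K * L / 2))..(K * L / 2), g (Y + (τ - Y 2) • eZ)‖ ≤ C := by
  have hHi : IntervalIntegrable (fun τ : ℝ => g (Y + (τ - Y 2) • eZ)) volume
      (-(K * L / 2)) (K * L / 2) :=
    (continuous_axialIntegrand hg Y).intervalIntegrable _ _
  have hlen : K * L / 2 - -(K * L / 2) = K * L := by ring
  have hrepr : g Y - (K * L)⁻¹ • ∫ τ in (-(K * L / 2))..(K * L / 2), g (Y + (τ - Y 2) • eZ) =
      (K * L)⁻¹ • ∫ τ in (-(K * L / 2))..(K * L / 2), (g Y - g (Y + (τ - Y 2) • eZ)) := by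
    rw [intervalIntegral.integral_sub intervalIntegrable_const hHi,
      intervalIntegral.integral_const, smul_sub, smul_smul, hlen,
      inv_mul_cancel₀ hKL.ne', one_smul]
  rw [hrepr, norm_smul, norm_inv, Real.norm_of_nonneg hKL.le]
  have hC : 0 ≤ C := (norm_nonneg _).trans (h 0 (by rw [abs_zero]; positivity))
  have hI : ‖∫ τ in (-(K * L / 2))..(K * L / 2), (g Y - g (Y + (τ - Y 2) • eZ))‖ ≤
      C * |K * L / 2 - -(K * L / 2)| :=
    intervalIntegral.norm_integral_le_of_norm_le_const fun τ hτ => by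
      rw [norm_sub_rev]
      refine h τ ?_
      rw [uIoc_of_le (by linarith)] at hτ
      exact abs_le.2 ⟨hτ.1.le, hτ.2⟩
  rw [hlen, abs_of_pos hKL] at hI
  calc (K * L)⁻¹ * ‖∫ τ in (-(K * L / 2))..(K * L / 2), (g Y - g (Y + (τ - Y 2) • eZ))‖
      ≤ (K * L)⁻¹ * (C * (K * L)) := by gcongr
    _ = C := by rw [mul_comm C, ← mul_assoc, inv_mul_cancel₀ hKL.ne', one_mul]

/-- **The new estimate: closeness to a columnar profile passes to the axial window average with a
factor `2`, on the half ball.**  If `g` is continuous and `y ↦ V⁻¹ g(L y)` is `K⁻¹`-close on `‖y‖ ≤ K` to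
a profile `W` invariant under vertical translations (`IsColumnar W`; `K, L, V > 0`), then for
`‖Y‖ ≤ KL/2`: `‖g Y − (KL)⁻¹ ∫_{−KL/2}^{KL/2} g(Y + (τ − Y₂)e_z) dτ‖ ≤ 2V/K`. [folklore] -/
theorem norm_sub_axialWindowAverage_le_of_close
    (g : EuclideanSpace ℝ (Fin 3) → EuclideanSpace ℝ (Fin 3)) (hg : Continuous g) (L V K : ℝ)
    (W : EuclideanSpace ℝ (Fin 3) → EuclideanSpace ℝ (Fin 3))
    (hL : 0 < L) (hV : 0 < V) (hK : 0 < K) (hW : IsColumnar W)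
    (hclose : ∀ y : EuclideanSpace ℝ (Fin 3), ‖y‖ ≤ K → ‖V⁻¹ • g (L • y) - W y‖ ≤ K⁻¹)
    (Y : EuclideanSpace ℝ (Fin 3)) (hY : ‖Y‖ ≤ K * L / 2) :
    ‖g Y - (K * L)⁻¹ • ∫ τ in (-(K * L / 2))..(K * L / 2), g (Y + (τ - Y 2) • eZ)‖ ≤ 2 * V / K := by
  have hKL : 0 < K * L := mul_pos hK hL
  refine norm_sub_axialWindowAverage_le hg hKL fun τ hτ => ?_
  set Z : EuclideanSpace ℝ (Fin 3) := Y + (τ - Y 2) • eZ with hZ_def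
  have hZ : ‖Z‖ ≤ K * L := norm_axialSample_le hKL.le Y hY hτ
  -- rescaled points
  set y : EuclideanSpace ℝ (Fin 3) := L⁻¹ • Y with hy_def
  set z : EuclideanSpace ℝ (Fin 3) := L⁻¹ • Z with hz_def
  have hyK : ‖y‖ ≤ K := by
    rw [hy_def, norm_smul, norm_inv, Real.norm_of_nonneg hL.le, inv_mul_le_iff₀ hL]
    nlinarith [norm_nonneg Y]
  have hzK : ‖z‖ ≤ K := by
    rw [hz_def, norm_smul, norm_inv, Real.norm_of_nonneg hL.le, inv_mul_le_iff₀ hL]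
    linarith [mul_comm K L]
  have hLy : L • y = Y := by rw [hy_def, smul_smul, mul_inv_cancel₀ hL.ne', one_smul]
  have hLz : L • z = Z := by rw [hz_def, smul_smul, mul_inv_cancel₀ hL.ne', one_smul]
  -- the profile takes the same value at `y` and `z = y + L⁻¹(τ - Y₂) e_z`
  have hWz : W z = W y := by
    have e : z = y + (L⁻¹ * (τ - Y 2)) • eZ := by
      rw [hz_def, hy_def, hZ_def, smul_add, smul_smul]
    rw [e]
    exact hW y _
  have h1 : ‖V⁻¹ • g Y - W y‖ ≤ K⁻¹ := by
    have := hclose y hyK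
    rwa [hLy] at this
  have h2 : ‖V⁻¹ • g Z - W y‖ ≤ K⁻¹ := by
    have := hclose z hzK
    rwa [hLz, hWz] at this
  have h3 : ‖V⁻¹ • (g Z - g Y)‖ ≤ 2 * K⁻¹ := by
    have : V⁻¹ • (g Z - g Y) = (V⁻¹ • g Z - W y) - (V⁻¹ • g Y - W y) := by
      rw [smul_sub]; abel
    rw [this]
    exact (norm_sub_le _ _).trans (by linarith)
  rw [norm_smul, norm_inv, Real.norm_of_nonneg hV.le, inv_mul_le_iff₀ hV] at h3
  calc ‖g Z - g Y‖ ≤ V * (2 * K⁻¹) := h3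
    _ = 2 * V / K := by rw [div_eq_mul_inv]; ring

/-- **The `C⁰` step of the construction stub, with `A = 2`.**  Let `f : ℝ³ → ℝ³` be continuous (a
velocity slice `u t`), bounded by `V > 0`, and suppose the recentred, rotated, rescaled slice
`y ↦ V⁻¹ Q⁻¹ f(x₀ + L Q y)` is `K⁻¹`-close on `‖y‖ ≤ K` to a columnar profile `W` (the closeness clause
of a level-`K` columnar core witness; `K, L > 0`).  Then the conjugated axial window average
`v₀ x := Q ḡ(Q⁻¹(x − x₀))`, `ḡ Y = (KL)⁻¹ ∫_{−KL/2}^{KL/2} Q⁻¹ f(x₀ + Q(Y + (τ − Y₂)e_z)) dτ`, is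
EXACTLY COLUMNAR along the witness axis (`v₀ (x + τ • Q e_z) = v₀ x`), bounded by `V`, and `2V/K`-close
to `f` on the closed half core ball `‖x − x₀‖ ≤ KL/2`. [folklore] -/
theorem exists_columnar_axialWindowAverage_close
    (f : EuclideanSpace ℝ (Fin 3) → EuclideanSpace ℝ (Fin 3)) (hf : Continuous f)
    (x₀ : EuclideanSpace ℝ (Fin 3)) (L V K : ℝ)
    (Q : EuclideanSpace ℝ (Fin 3) ≃ₗᵢ[ℝ] EuclideanSpace ℝ (Fin 3))
    (W : EuclideanSpace ℝ (Fin 3) → EuclideanSpace ℝ (Fin 3))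
    (hL : 0 < L) (hV : 0 < V) (hK : 0 < K) (hW : IsColumnar W)
    (hbd : ∀ x, ‖f x‖ ≤ V)
    (hclose : ∀ y : EuclideanSpace ℝ (Fin 3), ‖y‖ ≤ K →
      ‖V⁻¹ • Q.symm (f (x₀ + L • Q y)) - W y‖ ≤ K⁻¹) :
    ∃ v₀ : EuclideanSpace ℝ (Fin 3) → EuclideanSpace ℝ (Fin 3),
      (∀ (x : EuclideanSpace ℝ (Fin 3)) (τ : ℝ), v₀ (x + τ • Q eZ) = v₀ x) ∧
      (∀ x, ‖v₀ x‖ ≤ V) ∧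
      (∀ x ∈ closedBall x₀ (K * L / 2), ‖f x - v₀ x‖ ≤ 2 * V / K) := by
  have hKL : 0 < K * L := mul_pos hK hL
  -- the slice in witness coordinates and its axial window average
  set g : EuclideanSpace ℝ (Fin 3) → EuclideanSpace ℝ (Fin 3) := fun y => Q.symm (f (x₀ + Q y))
    with hg_def
  have hg : Continuous g := Q.symm.continuous.comp (hf.comp (continuous_const.add Q.continuous))
  obtain ⟨gbar, hgbar_def⟩ : ∃ gbar : EuclideanSpace ℝ (Fin 3) → EuclideanSpace ℝ (Fin 3),
      gbar = fun Y => (K * L)⁻¹ • ∫ τ in (-(K * L / 2))..(K * L / 2), g (Y + (τ - Y 2) • eZ) :=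
    ⟨_, rfl⟩
  -- columnarity of `gbar`: the sample points of `Y + σ e_z` and of `Y` coincide
  have hgbar_col : ∀ (Y : EuclideanSpace ℝ (Fin 3)) (σ : ℝ), gbar (Y + σ • eZ) = gbar Y := by
    intro Y σ
    rw [hgbar_def]
    dsimp only
    congr 1
    refine intervalIntegral.integral_congr fun τ _ => ?_
    rw [add_smul_eZ_apply_two, add_assoc, ← add_smul]
    congr 3
    ring
  have hclose_g : ∀ y : EuclideanSpace ℝ (Fin 3), ‖y‖ ≤ K → ‖V⁻¹ • g (L • y) - W y‖ ≤ K⁻¹ := by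
    intro y hy
    have e : x₀ + L • Q y = x₀ + Q (L • y) := by rw [map_smul]
    have := hclose y hy
    rw [e] at this
    exact this
  have hbar_close : ∀ Y : EuclideanSpace ℝ (Fin 3), ‖Y‖ ≤ K * L / 2 → ‖g Y - gbar Y‖ ≤ 2 * V / K :=
    fun Y hY => by
      rw [hgbar_def]
      exact norm_sub_axialWindowAverage_le_of_close g hg L V K W hL hV hK hW hclose_g Y hY
  have hbar_bd : ∀ Y, ‖gbar Y‖ ≤ V := by
    intro Y
    rw [hgbar_def]
    dsimp only
    rw [norm_smul, norm_inv, Real.norm_of_nonneg hKL.le]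
    have hI : ‖∫ τ in (-(K * L / 2))..(K * L / 2), g (Y + (τ - Y 2) • eZ)‖ ≤
        V * |K * L / 2 - -(K * L / 2)| :=
      intervalIntegral.norm_integral_le_of_norm_le_const fun τ _ => by
        rw [hg_def]; simp only [LinearIsometryEquiv.norm_map]; exact hbd _
    rw [show K * L / 2 - -(K * L / 2) = K * L by ring, abs_of_pos hKL] at hI
    calc (K * L)⁻¹ * ‖∫ τ in (-(K * L / 2))..(K * L / 2), g (Y + (τ - Y 2) • eZ)‖
        ≤ (K * L)⁻¹ * (V * (K * L)) := by gcongr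
      _ = V := by field_simp
  refine ⟨fun x => Q (gbar (Q.symm (x - x₀))), ?_, ?_, ?_⟩
  · intro x τ
    show Q (gbar (Q.symm (x + τ • Q eZ - x₀))) = Q (gbar (Q.symm (x - x₀)))
    rw [show x + τ • Q eZ - x₀ = (x - x₀) + τ • Q eZ by abel, map_add,
      LinearIsometryEquiv.map_smul, LinearIsometryEquiv.symm_apply_apply, hgbar_col]
  · intro x
    rw [LinearIsometryEquiv.norm_map]
    exact hbar_bd _
  · intro x hx
    set Y : EuclideanSpace ℝ (Fin 3) := Q.symm (x - x₀) with hY_def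
    have hY : ‖Y‖ ≤ K * L / 2 := by
      rw [hY_def, LinearIsometryEquiv.norm_map, ← dist_eq_norm]
      exact mem_closedBall.1 hx
    have hfx : f x = Q (g Y) := by
      rw [hg_def, hY_def]
      simp
    rw [hfx, ← map_sub, LinearIsometryEquiv.norm_map]
    exact hbar_close Y hY

/-- **The same, in the literal shape of the stub's clauses** (slice `u t`, open half core ball
`ball x₀ (K * L / 2)`, constant `A = 2`): the conjugated axial window average `v₀` of `u t` is columnar
along `Q e_z`, bounded by `V`, and `‖u t x - v₀ x‖ ≤ 2 * V / K` on `ball x₀ (K * L / 2)`.  This is the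
datum of `stub_columnarComparisonFlow` BEFORE the divergence correction; nothing downstream (corrector,
extension, 2½D flow) is done here. [folklore] -/
theorem exists_columnar_axialWindowAverage_close_ball
    (u : ℝ → EuclideanSpace ℝ (Fin 3) → EuclideanSpace ℝ (Fin 3)) (t : ℝ) (hu : Continuous (u t))
    (x₀ : EuclideanSpace ℝ (Fin 3)) (L V K : ℝ)
    (Q : EuclideanSpace ℝ (Fin 3) ≃ₗᵢ[ℝ] EuclideanSpace ℝ (Fin 3))
    (W : EuclideanSpace ℝ (Fin 3) → EuclideanSpace ℝ (Fin 3))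
    (hL : 0 < L) (hV : 0 < V) (hK : 0 < K) (hW : IsColumnar W)
    (hbd : ∀ x, ‖u t x‖ ≤ V)
    (hclose : ∀ y : EuclideanSpace ℝ (Fin 3), ‖y‖ ≤ K →
      ‖V⁻¹ • Q.symm (u t (x₀ + L • Q y)) - W y‖ ≤ K⁻¹) :
    ∃ v₀ : EuclideanSpace ℝ (Fin 3) → EuclideanSpace ℝ (Fin 3),
      (∀ (x : EuclideanSpace ℝ (Fin 3)) (τ : ℝ), v₀ (x + τ • Q eZ) = v₀ x) ∧
      (∀ x, ‖v₀ x‖ ≤ V) ∧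
      (∀ x ∈ ball x₀ (K * L / 2), ‖u t x - v₀ x‖ ≤ 2 * V / K) := by
  obtain ⟨v₀, hcol, hbd', hcl⟩ :=
    exists_columnar_axialWindowAverage_close (u t) hu x₀ L V K Q W hL hV hK hW hbd hclose
  exact ⟨v₀, hcol, hbd', fun x hx => hcl x (ball_subset_closedBall hx)⟩

end ColumnarComparisonDatum

end Summit.NavierStokesRegularity.NavierStokesRegularity.Theorems

end
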